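import Literature.Analysis.FluidPDE.NSEnstrophyBalanceRegular2D
import Literature.Analysis.FluidPDE.NSStrongSolutions2DProofs
import Literature.Analysis.FluidPDE.NSUniqueness2DProofs
import HarnessLib

/-!
# Navier–Stokes on `𝕋²`: the enstrophy balance of every Leray–Hopf solution — proofs
  (sibling proof file of `NSEnstrophyBalance2D`)

Trunk: FluidKinetic. The named fact
`Literature.Analysis.FluidPDE.fmrt_enstrophy_balance_torus2` (`NSEnstrophyBalance2D`;
Foias–Manley–Rosa–Temam 2001, Ch. II Thm. 7.4 with (7.14)/(7.17) and App. II.A (A.65)) says: on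
`𝕋²`, every global Leray–Hopf solution with datum `u₀ ∈ V` and a steady smooth force lies in
`L²(0,T;H²)` and satisfies the integrated enstrophy EQUATION from `t = 0`. Its proof has three
ingredients, all now in the tree:

1. *a strong solution with the enstrophy inequality exists* — `fmrt_strong_existence_torus2_holds`
   (`NSStrongSolutions2DProofs`, Galerkin; FMRT Thm. 7.4 existence half, (A.65)–(A.67));
2. *the weak solution is the strong one* — 2-D uniqueness, FMRT Thm. 7.3
   (`lions_prodi_uniqueness_torus2_holds`, `NSUniqueness2DProofs`), through the proved transfer
   `lions_prodi_uniqueness_torus2.enstrophy_regularity` (`NSStrongSolutions2D`): every Leray–Hopf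
   solution is in `L²(0,T;H²)` with `‖∇u(t)‖² + ν∫₀ᵗ‖Δu‖² ≤ ‖∇u₀‖² + ν⁻¹∫₀ᵗ‖f‖²`;
3. *regular solutions satisfy the enstrophy EQUATION* — `enstrophy_balance_of_regular_torus2_holds`
   (`NSEnstrophyBalanceRegular2D`; FMRT Remark 7.1, (A.62), (A.65)) on every `[s,t] ⊆ (0,T]`.

This file proves

* `Torus.IsLerayHopfOn.enstrophy_balance_from_zero` — the passage `s → 0⁺` in the balance on
  `[s,t]`, given a bound `‖∇u(s)‖² ≤ ‖∇u₀‖² + sM` (the `limsup` half of `u ∈ C([0,T];V)`,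
  FMRT Thm. 7.4; the `liminf` half is the tree's `IsLerayHopfOn.eGradNormSq_datum_le_liminf`);
* `fmrt_enstrophy_balance_torus2_of_uniqueness` — the target from the uniqueness fact:
  `lions_prodi_uniqueness_torus2 → fmrt_enstrophy_balance_torus2` (ingredients 1 and 3 being
  theorems);
* `fmrt_enstrophy_balance_torus2_holds` — **the unconditional discharge** of the named fact,
  feeding `lions_prodi_uniqueness_torus2_holds` to the previous theorem. (The alternative
  assembly `fmrt_enstrophy_balance_torus2_of` of `NSEnstrophyBalance2DGalerkin` would instead
  need the Galerkin convergence fact `galerkin_tendsto_lerayHopf_torus2`, not used here.)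

## References

* C. Foias, O. Manley, R. Rosa, R. Temam, *Navier–Stokes Equations and Turbulence*, CUP 2001,
  Ch. II Thm. 7.3–7.4, (7.14)–(7.17), Remark 7.1 (PDF pp. 70–73); App. II.A (A.62), (A.65)–(A.67)
  (PDF p. 118).
* S. Kuksin, A. Shirikyan, *Mathematics of Two-Dimensional Turbulence*, CUP 2012, Thm. 2.1.13,
  Thm. 2.1.18, Prop. 2.1.21 (ii).
-/

noncomputable section

open MeasureTheory TopologicalSpace Set Function Filter Topology UnitAddTorus
open scoped InnerProductSpace RealInnerProductSpace ENNReal NNReal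

namespace Literature.Analysis.FluidPDE

open FunctionSpaces.Torus Torus

/-! ### The passage `s → 0⁺` -/

/-- **The enstrophy balance from `t = 0`.** Let `u` be a Leray–Hopf solution on `𝕋² × [0,t)`,
`t > 0`, with steady smooth force `f` and datum `u₀ ∈ L²` of finite enstrophy, such that
(a) the balance `½‖∇u(t)‖² + ν∫ₛᵗ‖Δu‖² = ½‖∇u(s)‖² - ∫ₛᵗ∫⟪Δf,u⟫` holds for every `s ∈ (0,t)`,
(b) `‖∇u(s)‖² ≤ ‖∇u₀‖² + sM` on `(0,t]` for some `M`, and (c) `∫₀ᵗ‖Δu‖² < ∞`. Then the balance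
holds from `s = 0` with `‖∇u₀‖²` on the right: `s ↦ ½‖∇u(s)‖² + ∫₀ˢ∫⟪Δf,u⟫ + ν∫₀ˢ‖Δu‖²` is
constant on `(0,t)` and tends to `½‖∇u₀‖²` (`limsup` by (b), `liminf` by weak lower
semicontinuity at `0⁺`, `IsLerayHopfOn.eGradNormSq_datum_le_liminf`); this is the continuity
`u ∈ C([0,T];V)` of FMRT 2001, Thm. 7.4, in the amount needed. [cite: FoiasManleyRosaTemam2001, Ch. II Thm. 7.4 and (A.65)] -/
theorem Torus.IsLerayHopfOn.enstrophy_balance_from_zero {ν t : ℝ} {f u₀ : UnitAddTorus (Fin 2) → EuclideanSpace ℝ (Fin 2)}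
    {u : ℝ → UnitAddTorus (Fin 2) → EuclideanSpace ℝ (Fin 2)}
    (hu : Torus.IsLerayHopfOn t ν (fun _ => f) u₀ u) (ht : 0 < t) (hf : IsSmooth f)
    (hu₀ : MemLp u₀ 2 volume) (hZ₀ : eGradNormSq u₀ ≠ ⊤)
    (hbal : ∀ s, 0 < s → s < t →
      2⁻¹ * (eGradNormSq (u t)).toReal + ν * ∫ τ in Ioc s t, (eLaplacianNormSq (u τ)).toReal =
        2⁻¹ * (eGradNormSq (u s)).toReal - ∫ τ in Ioc s t, ∫ x, ⟪FunctionSpaces.Torus.laplacian f x, u τ x⟫)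
    {M : ℝ} (hup : ∀ s ∈ Ioc 0 t, eGradNormSq (u s) ≤ ENNReal.ofReal ((eGradNormSq u₀).toReal + s * M))
    (hlap : ∫⁻ τ in Ioo 0 t, eLaplacianNormSq (u τ) < ⊤) :
    2⁻¹ * (eGradNormSq (u t)).toReal + ν * ∫ τ in Ioc 0 t, (eLaplacianNormSq (u τ)).toReal =
      2⁻¹ * (eGradNormSq u₀).toReal - ∫ τ in Ioc 0 t, ∫ x, ⟪FunctionSpaces.Torus.laplacian f x, u τ x⟫ := by
  set Z₀ : ℝ := (eGradNormSq u₀).toReal with hZ₀_def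
  set Z : ℝ → ℝ := fun τ => (eGradNormSq (u τ)).toReal with hZ_def
  set P : ℝ → ℝ := fun τ => (eLaplacianNormSq (u τ)).toReal with hP_def
  set G : ℝ → ℝ := fun τ => ∫ x, ⟪FunctionSpaces.Torus.laplacian f x, u τ x⟫ with hG_def
  -- integrability on `(0, t]`
  have hPint : IntegrableOn P (Ioc 0 t) := Torus.integrableOn_toReal_eLaplacianNormSq hu hlap
  have hGint : IntegrableOn G (Ioc 0 t) := by
    rw [integrableOn_Ioc_iff_integrableOn_Ioo]
    have h := hu.integrableOn_integral_inner hf.laplacian.continuous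
    refine h.congr_fun (fun τ _ => ?_) measurableSet_Ioo
    exact integral_congr_ae (ae_of_all _ fun x => real_inner_comm _ _)
  -- splitting of the integrals at `s ∈ (0, t)`
  have hsplit : ∀ g : ℝ → ℝ, IntegrableOn g (Ioc 0 t) → ∀ s ∈ Ioo 0 t,
      ∫ τ in Ioc s t, g τ = (∫ τ in Ioc 0 t, g τ) - ∫ τ in Ioc 0 s, g τ := by
    intro g hg s hs
    rw [← Ioc_union_Ioc_eq_Ioc hs.1.le hs.2.le, setIntegral_union (Ioc_disjoint_Ioc_of_le le_rfl)
      measurableSet_Ioc (hg.mono_set (Ioc_subset_Ioc_right hs.2.le))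
      (hg.mono_set (Ioc_subset_Ioc_left hs.1.le))]
    ring
  -- the conserved combination
  have hconst : ∀ s ∈ Ioo 0 t,
      2⁻¹ * Z s + (∫ τ in Ioc 0 s, G τ) + ν * ∫ τ in Ioc 0 s, P τ =
        2⁻¹ * Z t + ν * (∫ τ in Ioc 0 t, P τ) + ∫ τ in Ioc 0 t, G τ := by
    intro s hs
    have h := hbal s hs.1 hs.2
    rw [hsplit P hPint s hs, hsplit G hGint s hs] at h
    linarith
  -- `Z s → Z₀` as `s → 0⁺`
  have hZlim : Tendsto Z (𝓝[>] 0) (𝓝 Z₀) := by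
    have hsup : limsup (fun s => eGradNormSq (u s)) (𝓝[>] 0) ≤ eGradNormSq u₀ := by
      have hb : Tendsto (fun s : ℝ => ENNReal.ofReal (Z₀ + s * M)) (𝓝[>] 0)
          (𝓝 (ENNReal.ofReal (Z₀ + 0 * M))) :=
        ((ENNReal.continuous_ofReal.tendsto _).comp
          ((continuous_const.add (continuous_id.mul continuous_const)).tendsto 0)).mono_left
          nhdsWithin_le_nhds
      rw [zero_mul, add_zero, hZ₀_def, ENNReal.ofReal_toReal hZ₀] at hb
      refine (limsup_le_limsup (Filter.eventually_of_mem (Ioc_mem_nhdsGT ht) fun s hs => hup s hs)).trans ?_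
      rw [hb.limsup_eq]
    have hinf : eGradNormSq u₀ ≤ liminf (fun s => eGradNormSq (u s)) (𝓝[>] 0) :=
      hu.eGradNormSq_datum_le_liminf ht hu₀
    exact (ENNReal.tendsto_toReal hZ₀).comp (tendsto_of_le_liminf_of_limsup_le hinf hsup)
  -- the integrals over `(0, s]` vanish as `s → 0⁺`
  have hprim : ∀ g : ℝ → ℝ, Tendsto (fun s => ∫ τ in Ioc 0 s, g τ) (𝓝[>] 0) (𝓝 0) := by
    intro g
    refine (tendsto_intervalIntegral_right_zero g 0).congr' ?_
    filter_upwards [self_mem_nhdsWithin] with s hs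
    exact intervalIntegral.integral_of_le (le_of_lt hs)
  have hlim : Tendsto (fun s => 2⁻¹ * Z s + (∫ τ in Ioc 0 s, G τ) + ν * ∫ τ in Ioc 0 s, P τ)
      (𝓝[>] 0) (𝓝 (2⁻¹ * Z₀ + 0 + ν * 0)) :=
    ((hZlim.const_mul _).add (hprim G)).add ((hprim P).const_mul _)
  have hlim' : Tendsto (fun s => 2⁻¹ * Z s + (∫ τ in Ioc 0 s, G τ) + ν * ∫ τ in Ioc 0 s, P τ)
      (𝓝[>] 0) (𝓝 (2⁻¹ * Z t + ν * (∫ τ in Ioc 0 t, P τ) + ∫ τ in Ioc 0 t, G τ)) :=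
    tendsto_const_nhds.congr' (Filter.eventually_of_mem (Ioo_mem_nhdsGT ht) fun s hs => (hconst s hs).symm)
  have heq := tendsto_nhds_unique hlim hlim'
  rw [add_zero, mul_zero, add_zero] at heq
  show 2⁻¹ * Z t + ν * (∫ τ in Ioc 0 t, P τ) = 2⁻¹ * Z₀ - ∫ τ in Ioc 0 t, G τ
  linarith

/-! ### The target from the uniqueness fact -/

/-- **`fmrt_enstrophy_balance_torus2` from 2-D uniqueness** (Foias–Manley–Rosa–Temam 2001,
Ch. II Thm. 7.3 ⇒ Thm. 7.4 for every weak solution, with (A.65)). Assume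
`lions_prodi_uniqueness_torus2` (FMRT Thm. 7.3, uniqueness of Leray–Hopf solutions on `𝕋²`).
Then every global Leray–Hopf solution with `u₀ ∈ V` and a steady smooth divergence-free force
(i) lies in `L²(0,T;H²)` for every `T > 0` and (ii) satisfies the integrated enstrophy EQUATION
from `t = 0`: (i) and the enstrophy INEQUALITY (hence `‖∇u(t)‖² ≤ ‖∇u₀‖² + ν⁻¹t‖f‖²` and
`∫₀ᵀ‖Δu‖² < ∞`) by the proved `fmrt_strong_existence_torus2_holds` and
`lions_prodi_uniqueness_torus2.enstrophy_regularity`; the equality on `[s,t]`, `s > 0`, by the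
proved `enstrophy_balance_of_regular_torus2_holds`; and `s → 0⁺` by
`IsLerayHopfOn.enstrophy_balance_from_zero`. [cite: FoiasManleyRosaTemam2001, Ch. II Thm. 7.3–7.4 and (A.65)] -/
theorem fmrt_enstrophy_balance_torus2_of_uniqueness (hU : lions_prodi_uniqueness_torus2) :
    fmrt_enstrophy_balance_torus2 := by
  intro ν hν f hf _hfdiv _hfmean u₀ hu₀H1 hu₀div u hu
  have hu₀ : MemLp u₀ 2 volume := memLp_of_memSobolev_complexify zero_le_one hu₀H1
  have hZ₀ : eGradNormSq u₀ ≠ ⊤ := eGradNormSq_ne_top_of_memSobolev_one hu₀H1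
  have hfm : AEStronglyMeasurable (stLift (fun _ : ℝ => f)) (volume.restrict (Ioi 0 ×ˢ univ)) :=
    aestronglyMeasurable_stLift_const hf _
  have hf₂ : ∀ T : ℝ, 0 < T → ∫⁻ _ in Ioo 0 T, ∫⁻ x, ‖f x‖ₑ ^ 2 < ⊤ := fun T _ =>
    lintegral_enorm_sq_const_lt_top hf T
  obtain ⟨hH2, hineq⟩ := lions_prodi_uniqueness_torus2.enstrophy_regularity (f := fun _ => f) hU
    fmrt_strong_existence_torus2_holds hν hu₀H1 hu₀div hfm hf₂ hu
  refine ⟨hH2, fun t ht => ?_⟩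
  have hut := hu t ht
  -- the space `L²` norm of the force
  have hF : ∫⁻ x, ‖f x‖ₑ ^ 2 < ⊤ := by
    have h := lintegral_enorm_sq_eq_ofReal (hf.memLp 2)
    rw [h]; exact ENNReal.ofReal_lt_top
  set Fsq : ℝ := (∫⁻ x, ‖f x‖ₑ ^ 2).toReal with hFsq
  -- the sup bound on `(0, t]` from the enstrophy inequality
  have hup : ∀ s ∈ Ioc 0 t, eGradNormSq (u s) ≤ ENNReal.ofReal ((eGradNormSq u₀).toReal + s * (ν⁻¹ * Fsq)) := by
    intro s hs
    have h1 := hineq s hs.1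
    have h2 : eGradNormSq (u s) ≤ eGradNormSq u₀ + ENNReal.ofReal ν⁻¹ * ∫⁻ τ in Ioo 0 s, ∫⁻ x, ‖f x‖ₑ ^ 2 :=
      le_trans le_self_add h1
    rw [setLIntegral_const, Real.volume_Ioo, sub_zero] at h2
    refine h2.trans (le_of_eq ?_)
    have hνF : 0 ≤ s * (ν⁻¹ * Fsq) :=
      mul_nonneg hs.1.le (mul_nonneg (inv_nonneg.2 hν.le) ENNReal.toReal_nonneg)
    rw [ENNReal.ofReal_add ENNReal.toReal_nonneg hνF, ENNReal.ofReal_toReal hZ₀,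
      show s * (ν⁻¹ * Fsq) = ν⁻¹ * (Fsq * s) by ring, ENNReal.ofReal_mul (inv_nonneg.2 hν.le),
      ENNReal.ofReal_mul ENNReal.toReal_nonneg, ENNReal.ofReal_toReal hF.ne]
  -- finiteness of the palinstrophy integral on `(0, t)`
  have hlap : ∫⁻ τ in Ioo 0 t, eLaplacianNormSq (u τ) < ⊤ := by
    have h1 := hineq t ht
    have hrhs : eGradNormSq u₀ + ENNReal.ofReal ν⁻¹ * ∫⁻ τ in Ioo 0 t, ∫⁻ x, ‖f x‖ₑ ^ 2 < ⊤ := by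
      refine ENNReal.add_lt_top.2 ⟨hZ₀.lt_top, ENNReal.mul_lt_top ENNReal.ofReal_lt_top ?_⟩
      rw [setLIntegral_const]
      exact ENNReal.mul_lt_top hF (by rw [Real.volume_Ioo]; exact ENNReal.ofReal_lt_top)
    have hmul : ENNReal.ofReal ν * ∫⁻ τ in Ioo 0 t, eLaplacianNormSq (u τ) < ⊤ :=
      lt_of_le_of_lt (le_add_self.trans h1) hrhs
    exact ENNReal.lt_top_of_mul_ne_top_right hmul.ne ((ENNReal.ofReal_pos.2 hν).ne')
  -- the regularity hypotheses of the balance on `[s, t]`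
  have hB : ∃ B : ℝ≥0, ∀ τ ∈ Ioc 0 t, eGradNormSq (u τ) ≤ B := by
    refine ⟨((eGradNormSq u₀).toReal + t * (ν⁻¹ * Fsq)).toNNReal, fun τ hτ => (hup τ hτ).trans
      (ENNReal.ofReal_le_ofReal ?_)⟩
    have : 0 ≤ ν⁻¹ * Fsq := mul_nonneg (inv_nonneg.2 hν.le) ENNReal.toReal_nonneg
    nlinarith [hτ.2]
  have hbal := enstrophy_balance_of_regular_torus2_holds ν t f u₀ u hν ht hf hu₀ hu₀div hut hB hlap
  exact hut.enstrophy_balance_from_zero ht hf hu₀ hZ₀ (fun s hs hst => hbal s t hs hst.le le_rfl) hup hlap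

/-- **Discharge of the named fact `fmrt_enstrophy_balance_torus2`** (Foias–Manley–Rosa–Temam
2001, Ch. II Thm. 7.4 with (7.14)/(7.17) and App. II.A (A.65); identification of the weak with
the strong solution by Thm. 7.3; Kuksin–Shirikyan 2012, Thm. 2.1.18, Prop. 2.1.21 (ii)): on `𝕋²`,
every global Leray–Hopf solution with datum `u₀ ∈ V` and a steady smooth divergence-free
mean-zero force lies in `L²(0,T;H²)` for every `T > 0` and satisfies the integrated enstrophy
equation `½‖∇u(t)‖₂² + ν∫₀ᵗ‖Δu‖₂² = ½‖∇u₀‖₂² - ∫₀ᵗ∫⟪Δf, u⟫` for every `t > 0` — by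
`fmrt_enstrophy_balance_torus2_of_uniqueness` and the tree's `lions_prodi_uniqueness_torus2_holds`. [cite: FoiasManleyRosaTemam2001, Ch. II Thm. 7.4 and (A.65)] -/
theorem fmrt_enstrophy_balance_torus2_holds : fmrt_enstrophy_balance_torus2 :=
  fmrt_enstrophy_balance_torus2_of_uniqueness lions_prodi_uniqueness_torus2_holds

end Literature.Analysis.FluidPDE
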